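import Mathlib
import HarnessLib
import Literature.NumberTheory.LFunctions.ApproxFunctionalEquation

/-!
# The Hardy–Littlewood–Weyl bound `ζ(1/2 + it) = O(t^{1/6} log t)` (Titchmarsh, Theorem 5.12)

Topic `Literature/NumberTheory/LFunctions`. A fully proved classical subconvexity bound for the
Riemann zeta function on the critical line:

* `Literature.NumberTheory.LFunctions.Titchmarsh1986_thm512` — `ζ(1/2 + it) = O(t^{1/6} log t)` as `t → +∞`
  (Titchmarsh, *The Theory of the Riemann Zeta-Function*, 2nd ed., Theorem 5.12), together with
  the explicit-inequality form `Literature.NumberTheory.LFunctions.norm_riemannZeta_half_le_weyl`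
  (`‖ζ(1/2 + it)‖ ≤ C t^{1/6} log t` for `t ≥ t₀`) and the corollary
  `Literature.NumberTheory.LFunctions.riemannZeta_half_isBigO_rpow_one_sixth_add`
  (`∀ ε > 0`, `ζ(1/2 + it) = O(t^{1/6 + ε})`), stated in the same shape as the named fact
  `Literature.NumberTheory.LFunctions.bourgain_subconvexity` (`13/84` in place of `1/6`) of
  `Literature/NumberTheory/LFunctions/RHWave0.lean`, so that users of that fact who only need some
  exponent `< 1/4` can be fed a theorem.

The proof is Titchmarsh's (§5.12), run through the approximate functional equation rather than
through `∑_{n < t}`: the third-derivative test (`Literature.NumberTheory.LFunctions.VdC.thirdDerivTest`, Titchmarsh Theorem 5.11)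
applied to `f(y) = (t/2π) log y` on `[M/2, M]`, where `f''' ≍ t/M³`, gives
`∑_{M/2 ≤ m ≤ M} m^{it} ≪ M^{1/2} t^{1/6} + M t^{-1/6}` (`Literature.NumberTheory.LFunctions.VdC.norm_sum_Icc_cpow_mul_I_le_third`),
hence `≪ M^{1/2} t^{1/6}` for `M ≤ √t`; dyadic dissection and partial summation
(`Literature.NumberTheory.LFunctions.norm_sum_cpow_mul_I_le_of_dyadic`, `Literature.NumberTheory.LFunctions.norm_sum_cpow_neg_half_le`) give
`∑_{n ≤ √(t/2π)} n^{-1/2 + it} ≪ t^{1/6} log t`, and the approximate functional equation on the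
critical line in the form `|ζ(1/2 + it)| ≤ 2 |∑_{n ≤ √(t/2π)} n^{-1/2 + it}| + O(1)`
(`Literature.NumberTheory.LFunctions.Bourgain2017_eq43_holds`, proved in
`Literature/NumberTheory/LFunctions/ApproxFunctionalEquation.lean`) concludes.

## References

* E. C. Titchmarsh, *The Theory of the Riemann Zeta-Function*, 2nd ed. (rev. D. R. Heath-Brown),
  Oxford 1986, Theorems 5.11, 5.12, eq. (5.12.1).
-/

noncomputable section

open Complex Filter Asymptotics
open scoped Real Topology

namespace Literature.NumberTheory.LFunctions
namespace VdC

open Finset Real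

/-- The third derivative of the phase family `phaseD (-t)` (`D₀(y) = (t/2π) log y`):
`D₃(y) = (t/π) / y³`. [folklore] -/
theorem phaseD_neg_three (t y : ℝ) : phaseD (-t) 3 y = t / π / y ^ 3 := by
  have h : phaseD (-t) 3 y
      = -t / (2 * π) * (-1) ^ (2 + 1) * (Nat.factorial 2 : ℝ) * y ^ (-((2 : ℤ) + 1)) :=
    phaseD_succ (-t) 2 y
  have h2 : (Nat.factorial 2 : ℝ) = 2 := by norm_num [Nat.factorial]
  have hz : y ^ (-((2 : ℤ) + 1)) = (y ^ 3)⁻¹ := by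
    rw [show (-((2 : ℤ) + 1)) = -((3 : ℕ) : ℤ) by norm_num, zpow_neg, zpow_natCast]
  rw [h, h2, hz]
  field_simp
  ring

/-- **Third-derivative bound for dyadic zeta sums** (the estimate in the proof of Titchmarsh's
Theorem 5.12): there is an absolute constant `C` with
`‖∑_{M/2 ≤ m ≤ M} m^{it}‖ ≤ C (M^{1/2} t^{1/6} + M t^{-1/6})` for all real `t ≥ 1`, `M ≥ 1`.
This is the third-derivative test (Titchmarsh Theorem 5.11, here `Literature.NumberTheory.LFunctions.VdC.thirdDerivTest`) for
`f(y) = (t/2π) log y` on `[M/2, M]`, where `f''' ≍ t/M³`: main term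
`M (t/M³)^{1/6} = M^{1/2} t^{1/6}`, secondary term `M^{1/2} (t/M³)^{-1/6} = M t^{-1/6}`; it is the
van der Corput estimate of the exponent pair `(1/6, 2/3) = AB(0,1)`.
[cite: Titchmarsh1986, Thm 5.11 and proof of Thm 5.12] -/
theorem norm_sum_Icc_cpow_mul_I_le_third :
    ∃ C : ℝ, 0 ≤ C ∧ ∀ t : ℝ, 1 ≤ t → ∀ M : ℝ, 1 ≤ M →
      ‖∑ m ∈ Finset.Icc ⌈M / 2⌉₊ ⌊M⌋₊, (m : ℂ) ^ ((t : ℂ) * Complex.I)‖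
        ≤ C * (M ^ (1 / 2 : ℝ) * t ^ (1 / 6 : ℝ) + M * t ^ (-(1 / 6 : ℝ))) := by
  refine ⟨2 * (96 * 64), by norm_num, ?_⟩
  intro t ht M hM
  have hM0 : 0 < M := by linarith
  have ht0 : 0 < t := by linarith
  have hmain1 : 1 ≤ M ^ (1 / 2 : ℝ) * t ^ (1 / 6 : ℝ) :=
    one_le_mul_of_one_le_of_one_le (Real.one_le_rpow hM (by norm_num))
      (Real.one_le_rpow ht (by norm_num))
  have hsec0 : 0 ≤ M * t ^ (-(1 / 6 : ℝ)) := by positivity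
  set c : ℕ := ⌈M / 2⌉₊ with hc
  set f : ℕ := ⌊M⌋₊ with hf
  have hcM : M / 2 ≤ c := Nat.le_ceil _
  have hcM' : (c : ℝ) < M / 2 + 1 := Nat.ceil_lt_add_one (by positivity)
  have hfM : (f : ℝ) ≤ M := Nat.floor_le hM0.le
  have hfM' : M - 1 < f := by
    have := Nat.lt_floor_add_one M
    linarith
  by_cases hM8 : M < 8
  · -- small `M`: trivial bound
    have hcard : ‖∑ m ∈ Finset.Icc c f, (m : ℂ) ^ ((t : ℂ) * Complex.I)‖ ≤ 5 := by
      refine (norm_sum_le _ _).trans ?_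
      have h1 : ∀ m ∈ Finset.Icc c f, ‖(m : ℂ) ^ ((t : ℂ) * Complex.I)‖ ≤ 1 := by
        intro m hm
        have hc1 : 1 ≤ c := Nat.one_le_iff_ne_zero.2 (Nat.ceil_pos.2 (by positivity)).ne'
        have hm0 : 0 < m := lt_of_lt_of_le hc1 (Finset.mem_Icc.1 hm).1
        rw [Complex.norm_natCast_cpow_of_pos hm0]
        simp
      refine (Finset.sum_le_sum h1).trans ?_
      rw [Finset.sum_const, nsmul_eq_mul, mul_one, Nat.card_Icc]
      rcases le_or_gt c (f + 1) with h | h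
      · rw [Nat.cast_sub h]
        push_cast
        linarith
      · rw [Nat.sub_eq_zero_of_le h.le]
        norm_num
    calc ‖∑ m ∈ Finset.Icc c f, (m : ℂ) ^ ((t : ℂ) * Complex.I)‖ ≤ 5 := hcard
      _ ≤ 5 * (M ^ (1 / 2 : ℝ) * t ^ (1 / 6 : ℝ)) := by nlinarith
      _ ≤ 2 * (96 * 64)
          * (M ^ (1 / 2 : ℝ) * t ^ (1 / 6 : ℝ) + M * t ^ (-(1 / 6 : ℝ))) := by
          nlinarith
  · -- `M ≥ 8`: third derivative test on `(j, f]`, `j = ⌈M/2⌉ - 1`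
    rw [not_lt] at hM8
    obtain ⟨j, hj⟩ : ∃ j : ℕ, c = j + 1 :=
      ⟨c - 1, by have := Nat.ceil_pos.2 (show 0 < M / 2 by positivity); omega⟩
    have hcj : (c : ℝ) = j + 1 := by rw [hj]; push_cast; ring
    have hjM : M / 2 - 1 ≤ j := by linarith
    have hjM' : (j : ℝ) < M / 2 := by linarith
    have hj4 : M / 4 ≤ j := by linarith
    have hj0 : (0 : ℝ) < j := by linarith
    have hjf : (j : ℤ) < f := by
      have : (j : ℝ) < f := by linarith
      exact_mod_cast this
    set L : ℝ := ((f : ℤ) : ℝ) - ((j : ℤ) : ℝ) with hLdef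
    have hL : L ≤ M := by rw [hLdef]; push_cast; linarith
    have hL0 : 0 < L := by rw [hLdef]; push_cast; linarith
    rw [hj, sum_Icc_cpow_mul_I_eq_sum_e_phaseD t j f]
    -- the size parameter `λ = (t/π) / M³` of the third derivative
    set K : ℝ := t / π with hK
    have hπ : 0 < π := Real.pi_pos
    have hK0 : 0 < K := by positivity
    have hKt : K ≤ t := by
      rw [hK, div_le_iff₀ hπ]
      nlinarith [Real.pi_gt_three]
    have htK : t / 4 ≤ K := by
      rw [hK, div_le_div_iff₀ (by norm_num) hπ]
      nlinarith [Real.pi_lt_four]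
    set lam : ℝ := K / M ^ 3 with hlam
    have hlam0 : 0 < lam := by positivity
    have hfam : DerivFamily (phaseD (-t)) ((j : ℤ) : ℝ) ((f : ℤ) : ℝ) 3 :=
      phaseD_derivFamily (-t) (by push_cast; exact hj0) 3
    have hbound : ∀ y ∈ Set.Icc ((j : ℤ) : ℝ) ((f : ℤ) : ℝ),
        lam ≤ phaseD (-t) 3 y ∧ phaseD (-t) 3 y ≤ 64 * lam := by
      intro y hy
      push_cast at hy
      have hy0 : 0 < y := by linarith [hy.1]
      have hyM : y ≤ M := by linarith [hy.2]
      have hyM' : M / 4 ≤ y := by linarith [hy.1]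
      rw [phaseD_neg_three t y]
      constructor
      · exact div_le_div_of_nonneg_left hK0.le (by positivity) (pow_le_pow_left₀ hy0.le hyM 3)
      · calc K / y ^ 3 ≤ K / (M / 4) ^ 3 :=
            div_le_div_of_nonneg_left hK0.le (by positivity) (pow_le_pow_left₀ (by positivity) hyM' 3)
          _ = 64 * lam := by
            rw [hlam]
            field_simp
            ring
    have hKb := thirdDerivTest (h := 64) (by norm_num) lam hlam0 (j : ℤ) (f : ℤ) hjf (phaseD (-t))
      hfam hbound
    -- bookkeeping
    have e1 : lam ^ (1 / 6 : ℝ) = K ^ (1 / 6 : ℝ) * M ^ (-(1 / 2) : ℝ) := by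
      rw [hlam, Real.div_rpow hK0.le (by positivity), div_eq_mul_inv,
        ← Real.rpow_neg (by positivity), ← Real.rpow_natCast M 3, ← Real.rpow_mul hM0.le]
      norm_num
    have e2 : lam ^ (-(1 / 6) : ℝ) = K ^ (-(1 / 6) : ℝ) * M ^ (1 / 2 : ℝ) := by
      rw [hlam, Real.div_rpow hK0.le (by positivity), div_eq_mul_inv,
        ← Real.rpow_neg (by positivity), ← Real.rpow_natCast M 3, ← Real.rpow_mul hM0.le]
      norm_num
    have hK1 : K ^ (1 / 6 : ℝ) ≤ t ^ (1 / 6 : ℝ) := Real.rpow_le_rpow hK0.le hKt (by norm_num)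
    have h4le : (4 : ℝ) ^ (1 / 6 : ℝ) ≤ 2 := by
      have h4 : (4 : ℝ) = 2 ^ (2 : ℝ) := by norm_num
      rw [h4, ← Real.rpow_mul (by norm_num)]
      calc (2 : ℝ) ^ (2 * (1 / 6) : ℝ) ≤ (2 : ℝ) ^ (1 : ℝ) :=
            Real.rpow_le_rpow_of_exponent_le (by norm_num) (by norm_num)
        _ = 2 := Real.rpow_one 2
    have hK2 : K ^ (-(1 / 6) : ℝ) ≤ 2 * t ^ (-(1 / 6) : ℝ) := by
      calc K ^ (-(1 / 6) : ℝ) ≤ (t / 4) ^ (-(1 / 6) : ℝ) :=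
            Real.rpow_le_rpow_of_nonpos (by positivity) htK (by norm_num)
        _ = t ^ (-(1 / 6) : ℝ) * (4 : ℝ) ^ (1 / 6 : ℝ) := by
            rw [Real.div_rpow ht0.le (by norm_num), Real.rpow_neg (by norm_num : (0 : ℝ) ≤ 4),
              div_inv_eq_mul]
        _ ≤ t ^ (-(1 / 6) : ℝ) * 2 := mul_le_mul_of_nonneg_left h4le (by positivity)
        _ = 2 * t ^ (-(1 / 6) : ℝ) := by ring
    have hI : L * lam ^ (1 / 6 : ℝ) ≤ M ^ (1 / 2 : ℝ) * t ^ (1 / 6 : ℝ) := by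
      rw [e1]
      calc L * (K ^ (1 / 6 : ℝ) * M ^ (-(1 / 2) : ℝ))
          ≤ M * (t ^ (1 / 6 : ℝ) * M ^ (-(1 / 2) : ℝ)) :=
            mul_le_mul hL (mul_le_mul_of_nonneg_right hK1 (by positivity)) (by positivity) hM0.le
        _ = M ^ (1 / 2 : ℝ) * t ^ (1 / 6 : ℝ) := by
            have h := Real.rpow_add hM0 1 (-(1 / 2))
            rw [Real.rpow_one] at h
            have : M ^ (1 / 2 : ℝ) = M * M ^ (-(1 / 2) : ℝ) := by
              rw [← h]
              norm_num
            rw [this]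
            ring
    have hII : L ^ (1 - 1 / 2 : ℝ) * lam ^ (-(1 / 6 : ℝ)) ≤ 2 * (M * t ^ (-(1 / 6 : ℝ))) := by
      rw [show (-(1 / 6 : ℝ)) = (-(1 / 6) : ℝ) by norm_num, show (1 - 1 / 2 : ℝ) = 1 / 2 by norm_num,
        e2]
      have hL12 : L ^ (1 / 2 : ℝ) ≤ M ^ (1 / 2 : ℝ) := Real.rpow_le_rpow hL0.le hL (by norm_num)
      calc L ^ (1 / 2 : ℝ) * (K ^ (-(1 / 6) : ℝ) * M ^ (1 / 2 : ℝ))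
          ≤ M ^ (1 / 2 : ℝ) * ((2 * t ^ (-(1 / 6) : ℝ)) * M ^ (1 / 2 : ℝ)) :=
            mul_le_mul hL12 (mul_le_mul_of_nonneg_right hK2 (by positivity)) (by positivity)
              (by positivity)
        _ = (M ^ (1 / 2 : ℝ) * M ^ (1 / 2 : ℝ)) * (2 * t ^ (-(1 / 6) : ℝ)) := by ring
        _ = 2 * (M * t ^ (-(1 / 6) : ℝ)) := by
            rw [← Real.rpow_add hM0, show (1 / 2 : ℝ) + 1 / 2 = 1 by norm_num, Real.rpow_one]
            ring
    refine hKb.trans ?_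
    have h9664 : (0 : ℝ) ≤ 96 * 64 := by norm_num
    calc 96 * 64 * (L * lam ^ (1 / 6 : ℝ) + L ^ (1 - 1 / 2 : ℝ) * lam ^ (-(1 / 6 : ℝ)))
        ≤ 96 * 64 * (M ^ (1 / 2 : ℝ) * t ^ (1 / 6 : ℝ) + 2 * (M * t ^ (-(1 / 6 : ℝ)))) :=
          mul_le_mul_of_nonneg_left (add_le_add hI hII) h9664
      _ ≤ 2 * (96 * 64) * (M ^ (1 / 2 : ℝ) * t ^ (1 / 6 : ℝ) + M * t ^ (-(1 / 6 : ℝ))) := by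
          nlinarith [hmain1, hsec0]

end VdC
end Literature.NumberTheory.LFunctions

namespace Literature.NumberTheory.LFunctions

open Finset

/-- **(5.12.1) summed up to `x = √(t/2π)`.** There is an absolute constant `C` with
`‖∑_{1 ≤ n ≤ ⌊√(t/2π)⌋} n^{-1/2 + it}‖ ≤ C t^{1/6} (2 + log t)` for all `t ≥ 2π`: the block bound
`Literature.NumberTheory.LFunctions.VdC.norm_sum_Icc_cpow_mul_I_le_third` gives `‖∑_{M/2 ≤ m ≤ M} m^{it}‖ ≤ 2C √M t^{1/6}`
for `1 ≤ M ≤ √(t/2π)` (there `M t^{-1/6} ≤ √M t^{1/4 - 1/6} ≤ √M t^{1/6}`), and dyadic dissection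
plus partial summation (`norm_sum_cpow_mul_I_le_of_dyadic`, `norm_sum_cpow_neg_half_le`) turn
this into the stated bound (`log ⌊√(t/2π)⌋ ≤ log t`).
[cite: Titchmarsh1986, proof of Thm 5.12, eq. (5.12.1)] -/
theorem norm_sum_cpow_neg_half_le_weyl :
    ∃ C : ℝ, 0 ≤ C ∧ ∀ t : ℝ, 2 * π ≤ t →
      ‖∑ n ∈ Finset.Icc 1 ⌊Real.sqrt (t / (2 * π))⌋₊, (n : ℂ) ^ (-(1 / 2 : ℂ) + t * I)‖
        ≤ C * t ^ (1 / 6 : ℝ) * (2 + Real.log t) := by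
  obtain ⟨C, hC0, hC⟩ := Literature.NumberTheory.LFunctions.VdC.norm_sum_Icc_cpow_mul_I_le_third
  refine ⟨4 * (2 * C), by positivity, fun t ht => ?_⟩
  have hπ : 0 < π := Real.pi_pos
  have hπ3 : 3 < π := Real.pi_gt_three
  have ht1 : 1 ≤ t := by linarith
  have ht0 : 0 < t := by linarith
  set T : ℝ := t / (2 * π) with hT
  have hT1 : 1 ≤ T := by
    rw [hT, le_div_iff₀ (by positivity)]
    linarith
  have hTpos : 0 < T := by linarith
  have hTt : T ≤ t := by
    rw [hT, div_le_iff₀ (by positivity)]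
    nlinarith
  set X : ℝ := Real.sqrt T with hX
  set N : ℕ := ⌊X⌋₊ with hN
  set B : ℝ := t ^ (1 / 6 : ℝ) with hBdef
  have hBnn : 0 ≤ B := by positivity
  have hXT : X ≤ T := by
    calc X = Real.sqrt T := rfl
      _ ≤ Real.sqrt (T ^ 2) := Real.sqrt_le_sqrt (by nlinarith)
      _ = T := Real.sqrt_sq hTpos.le
  have hXt4 : X ≤ t ^ (1 / 2 : ℝ) := by
    calc X = Real.sqrt T := rfl
      _ ≤ Real.sqrt t := Real.sqrt_le_sqrt hTt
      _ = t ^ (1 / 2 : ℝ) := Real.sqrt_eq_rpow t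
  -- block bound in the `√M · B` currency
  have hblock : ∀ M : ℝ, 1 ≤ M → M ≤ X →
      ‖∑ m ∈ Finset.Icc ⌈M / 2⌉₊ ⌊M⌋₊, (m : ℂ) ^ ((t : ℂ) * I)‖ ≤ 2 * C * Real.sqrt M * B := by
    intro M hM1 hMX
    have hM0 : 0 < M := by linarith
    have h := hC t ht1 M hM1
    have hsqrt : M ^ (1 / 2 : ℝ) = Real.sqrt M := (Real.sqrt_eq_rpow M).symm
    -- `M t^{-1/6} ≤ √M · B`
    have hMs : Real.sqrt M ≤ t ^ (1 / 4 : ℝ) := by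
      calc Real.sqrt M ≤ Real.sqrt X := Real.sqrt_le_sqrt hMX
        _ ≤ Real.sqrt (t ^ (1 / 2 : ℝ)) := Real.sqrt_le_sqrt hXt4
        _ = t ^ (1 / 4 : ℝ) := by
            rw [Real.sqrt_eq_rpow, ← Real.rpow_mul ht0.le]
            norm_num
    have hsec : M * t ^ (-(1 / 6 : ℝ)) ≤ Real.sqrt M * B := by
      have hMM : M = Real.sqrt M * Real.sqrt M := (Real.mul_self_sqrt hM0.le).symm
      have h1 : Real.sqrt M * t ^ (-(1 / 6 : ℝ)) ≤ B := by
        calc Real.sqrt M * t ^ (-(1 / 6 : ℝ)) ≤ t ^ (1 / 4 : ℝ) * t ^ (-(1 / 6 : ℝ)) :=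
              mul_le_mul_of_nonneg_right hMs (by positivity)
          _ = t ^ (1 / 12 : ℝ) := by
              rw [← Real.rpow_add ht0]
              norm_num
          _ ≤ t ^ (1 / 6 : ℝ) := Real.rpow_le_rpow_of_exponent_le ht1 (by norm_num)
      calc M * t ^ (-(1 / 6 : ℝ)) = Real.sqrt M * (Real.sqrt M * t ^ (-(1 / 6 : ℝ))) := by
            conv_lhs => rw [hMM]
            ring
        _ ≤ Real.sqrt M * B := mul_le_mul_of_nonneg_left h1 (Real.sqrt_nonneg _)
    calc ‖∑ m ∈ Finset.Icc ⌈M / 2⌉₊ ⌊M⌋₊, (m : ℂ) ^ ((t : ℂ) * I)‖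
        ≤ C * (M ^ (1 / 2 : ℝ) * t ^ (1 / 6 : ℝ) + M * t ^ (-(1 / 6 : ℝ))) := h
      _ ≤ C * (Real.sqrt M * B + Real.sqrt M * B) := by
          rw [hsqrt]
          exact mul_le_mul_of_nonneg_left (add_le_add le_rfl hsec) hC0
      _ = 2 * C * Real.sqrt M * B := by ring
  -- dyadic dissection
  have hdy := norm_sum_cpow_mul_I_le_of_dyadic (by positivity : (0 : ℝ) ≤ 2 * C) hBnn hblock
  have hAK : ∀ K : ℕ, K ≤ N →
      ‖∑ n ∈ Finset.Ioc 0 K, (n : ℂ) ^ ((t : ℂ) * I)‖ ≤ 4 * (2 * C) * Real.sqrt K * B := by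
    intro K hK
    have hKX : (K : ℝ) ≤ X := le_trans (by exact_mod_cast hK) (Nat.floor_le (Real.sqrt_nonneg _))
    have := hdy K hKX
    linarith
  -- partial summation
  have hP := norm_sum_cpow_neg_half_le (by positivity : (0 : ℝ) ≤ 4 * (2 * C)) hBnn N hAK
  -- `log N ≤ log t`
  have hNX : (N : ℝ) ≤ X := Nat.floor_le (Real.sqrt_nonneg _)
  have hlogN : Real.log N ≤ Real.log t := by
    rcases Nat.eq_zero_or_pos N with hN0 | hNpos
    · rw [hN0]
      simp only [Nat.cast_zero, Real.log_zero]
      exact Real.log_nonneg ht1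
    · exact Real.log_le_log (by exact_mod_cast hNpos) (hNX.trans (hXT.trans hTt))
  calc ‖∑ n ∈ Finset.Icc 1 N, (n : ℂ) ^ (-(1 / 2 : ℂ) + t * I)‖
      ≤ 4 * (2 * C) * B * (2 + Real.log N) := hP
    _ ≤ 4 * (2 * C) * B * (2 + Real.log t) := by gcongr
    _ = 4 * (2 * C) * t ^ (1 / 6 : ℝ) * (2 + Real.log t) := by rw [hBdef]

/-- **Titchmarsh, Theorem 5.12 (explicit-inequality form).** There are `C, t₀` with
`‖ζ(1/2 + it)‖ ≤ C t^{1/6} log t` for all `t ≥ t₀`: combine `norm_sum_cpow_neg_half_le_weyl` with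
the approximate functional equation on the critical line
`|ζ(1/2 + it)| ≤ 2 |∑_{n ≤ √(t/2π)} n^{-1/2 + it}| + O(1)` (`Bourgain2017_eq43_holds`,
Titchmarsh (4.17.1)/Theorem 4.13 on `σ = 1/2`), and absorb `2 + log t ≤ 2 log t` (`t ≥ e²`) and the
`O(1)`. [cite: Titchmarsh1986, Thm 5.12] -/
theorem norm_riemannZeta_half_le_weyl :
    ∃ C t₀ : ℝ, ∀ t : ℝ, t₀ ≤ t →
      ‖riemannZeta (1 / 2 + t * I)‖ ≤ C * t ^ (1 / 6 : ℝ) * Real.log t := by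
  obtain ⟨C, hC0, hC⟩ := norm_sum_cpow_neg_half_le_weyl
  obtain ⟨C_A, t_A, hA⟩ := Bourgain2017_eq43_holds
  refine ⟨4 * C + |C_A|, max t_A (max (2 * π) (Real.exp 2)), fun t ht => ?_⟩
  have ht_A : t_A ≤ t := (le_max_left _ _).trans ht
  have ht2π : 2 * π ≤ t := ((le_max_left _ _).trans (le_max_right _ _)).trans ht
  have hte : Real.exp 2 ≤ t := ((le_max_right _ _).trans (le_max_right _ _)).trans ht
  have hπ3 : 3 < π := Real.pi_gt_three
  have ht1 : 1 ≤ t := by linarith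
  have ht0 : 0 < t := by linarith
  have hlog2 : 2 ≤ Real.log t := by
    rw [Real.le_log_iff_exp_le ht0]
    exact hte
  have hlog1 : 1 ≤ Real.log t := by linarith
  have ht16 : 1 ≤ t ^ (1 / 6 : ℝ) := Real.one_le_rpow ht1 (by norm_num)
  have hS := hC t ht2π
  have hZ := hA t ht_A
  have hCA : C_A ≤ |C_A| * t ^ (1 / 6 : ℝ) * Real.log t :=
    calc C_A ≤ |C_A| := le_abs_self _
      _ ≤ |C_A| * t ^ (1 / 6 : ℝ) := le_mul_of_one_le_right (abs_nonneg _) ht16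
      _ ≤ |C_A| * t ^ (1 / 6 : ℝ) * Real.log t := le_mul_of_one_le_right (by positivity) hlog1
  calc ‖riemannZeta (1 / 2 + t * I)‖
      ≤ 2 * ‖∑ n ∈ Finset.Icc 1 ⌊Real.sqrt (t / (2 * π))⌋₊, (n : ℂ) ^ (-(1 / 2 : ℂ) + t * I)‖
          + C_A := hZ
    _ ≤ 2 * (C * t ^ (1 / 6 : ℝ) * (2 + Real.log t)) + |C_A| * t ^ (1 / 6 : ℝ) * Real.log t :=
        add_le_add (by gcongr) hCA
    _ ≤ 2 * (C * t ^ (1 / 6 : ℝ) * (2 * Real.log t)) + |C_A| * t ^ (1 / 6 : ℝ) * Real.log t := by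
        gcongr
        linarith
    _ = (4 * C + |C_A|) * t ^ (1 / 6 : ℝ) * Real.log t := by ring

/-- **Titchmarsh, Theorem 5.12** (Hardy–Littlewood 1921 / Weyl): `ζ(1/2 + it) = O(t^{1/6} log t)`
as `t → +∞`. [cite: Titchmarsh1986, Thm 5.12] -/
theorem Titchmarsh1986_thm512 :
    (fun t : ℝ => riemannZeta (1 / 2 + t * I)) =O[atTop]
      fun t : ℝ => t ^ (1 / 6 : ℝ) * Real.log t := by
  obtain ⟨C, t₀, h⟩ := norm_riemannZeta_half_le_weyl
  refine Asymptotics.IsBigO.of_bound C ?_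
  filter_upwards [Filter.eventually_ge_atTop t₀, Filter.eventually_ge_atTop 1] with t ht ht1
  have hnn : 0 ≤ t ^ (1 / 6 : ℝ) * Real.log t :=
    mul_nonneg (by positivity) (Real.log_nonneg ht1)
  rw [Real.norm_of_nonneg hnn]
  calc ‖riemannZeta (1 / 2 + t * I)‖ ≤ C * t ^ (1 / 6 : ℝ) * Real.log t := h t ht
    _ = C * (t ^ (1 / 6 : ℝ) * Real.log t) := by ring

/-- **Corollary** (the Weyl exponent `1/6` in the shape of `Literature.NumberTheory.LFunctions.bourgain_subconvexity`): for every
`ε > 0`, `ζ(1/2 + it) = O(t^{1/6 + ε})` as `t → +∞` (`log t = o(t^ε)`). Users of the named fact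
`bourgain_subconvexity` (`13/84 + ε`) who only need an exponent `< 1/4` can use this theorem
instead. [cite: Titchmarsh1986, Thm 5.12] -/
theorem riemannZeta_half_isBigO_rpow_one_sixth_add :
    ∀ (ε : ℝ) (_hε : 0 < ε),
      (fun t : ℝ ↦ riemannZeta (1 / 2 + t * I)) =O[atTop] fun t ↦ t ^ (1 / 6 + ε) := by
  intro ε hε
  refine Titchmarsh1986_thm512.trans ?_
  have h1 : (fun t : ℝ => Real.log t) =o[atTop] fun t => t ^ ε := isLittleO_log_rpow_atTop hε
  have h2 : (fun t : ℝ => t ^ (1 / 6 : ℝ) * Real.log t) =o[atTop]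
      fun t => t ^ (1 / 6 : ℝ) * t ^ ε :=
    (Asymptotics.isBigO_refl (fun t : ℝ => t ^ (1 / 6 : ℝ)) atTop).mul_isLittleO h1
  have h3 : (fun t : ℝ => t ^ (1 / 6 : ℝ) * t ^ ε) =ᶠ[atTop] fun t => t ^ (1 / 6 + ε) := by
    filter_upwards [Filter.eventually_gt_atTop 0] with t ht
    rw [← Real.rpow_add ht]
  exact h2.isBigO.trans h3.isBigO

end Literature.NumberTheory.LFunctions
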